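import Summits.QuantumFields.GaugeBoot.DiagonalRPTorusWordChart
import HarnessLib

/-!
# A kernel-checkable gluing script for word-list Haar integrals (gauge-boot, L3 `d = 3` uniform window, J2 brick 3)

HONEST FRAMING (cell `pub-gaugeboot`, page 1 of every file): the venture produces certified bounds
on lattice expectations at stated coupling, gauge group, dimension and torus size; NOT a mass gap,
NOT a continuum limit, NOT a string tension; NOT Yang–Mills-summit-bearing (barriers
`FixedCouplingUltralocality`, `PerturbativeInvisibility`). This module is bookkeeping for a
structural NEGATIVE result (a coupling window UNIFORM in the torus size for the failure of
inner-half diagonal reflection positivity on `(ℤ/L)^3`, plan note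
`HOME/pub-gaugeboot-lean3/gen46/D3-UNIFORM-PLAN.md` §3 item 6c (J2)); it discharges nothing by
itself.

## Content (chart `DiagRPHex.site y`, torus `(ℤ/L)^3`, compact metrisable `G`, continuous `ρ`)

Strong-coupling diagrams `∫ ∏ Re χ(hol(w_i)) dU` of locally based words are evaluated by a SCRIPT
of certified rewrite steps (`DiagonalRPTorusWordGlue`), checked by computation:

* `GOp` — `glue i j ki kj` (glue the words `i` (reading the link backward at position `ki`) and
  `j` (forward at `kj`, closed) along that link: factor `c₁`), `rot i` (rotate a closed word),
  `bt i k` (cancel a backtrack at position `k`), `nilw i` (drop an empty word: factor `N`),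
  `rev i` (reverse a closed word; `reTr_wordHolonomy_reverse`);
  `applyOp`, `runOps` — the checker (all side conditions decided on local data: multiplicities
  of local links, closedness, the box);
* ★★ **`wlInt_eq_of_runOps`** — if `runOps B ops ws = some (a, b)` (the script consumes every
  word), then `wlInt ρ (chartWords y ws) = c₁ ^ a * N ^ b` under (R1) (`2B < L`);
* ★ **`wlInt_eq_zero_of_hasLonely`** — if some word reads some link of local multiplicity one in
  the whole list (`hasLonely`, decided), the integral VANISHES under the centre twist.

Elementary given bricks 1–2; no named fact. The scripts themselves (the annulus value
`c₁^{11} N` and the vanishing of its proper sub-diagrams) are brick 4.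
-/

open MeasureTheory Finset Function

namespace Summit.QuantumFields.GaugeBoot

open Literature.MathematicalPhysics.QuantumFieldTheory
open Literature.MathematicalPhysics.QuantumFieldTheory.PlaquetteLowerBound (reTr)

noncomputable section

namespace DiagRPHex

/-! ## The script language and its checker -/

/-- Script operations. -/
inductive GOp : Type
  /-- glue word `i` (backward reader at `ki`) with the closed word `j` (forward reader at `kj`) -/
  | glue (i j ki kj : ℕ)
  /-- rotate the closed word `i` by one step -/
  | rot (i : ℕ)
  /-- cancel the backtrack at positions `k, k+1` of word `i` -/
  | bt (i k : ℕ)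
  /-- drop the empty word `i` -/
  | nilw (i : ℕ)
  /-- reverse the closed word `i` (`Re χ(h⁻¹) = Re χ(h)`) -/
  | rev (i : ℕ)

/-- All words of the list read links of the box only. -/
def allInBox (B : ℕ) (ws : List (LSite × Word 3)) : Bool := ws.all fun xw => ledgesInBox B xw.1 xw.2

/-- The glue step on explicit data: the merged word, if every side condition holds. -/
def glueData (B : ℕ) (a b : LSite × Word 3) (ki kj : ℕ) (rest : List (LSite × Word 3)) :
    Option (LSite × Word 3) :=
  match (ledges a.1 a.2)[ki]?, (ledges b.1 b.2)[kj]?, a.2[ki]?, b.2[kj]? with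
  | some ℓ, some ℓ', some si, some sj =>
    if ℓ' = ℓ ∧ si.isFwd = false ∧ sj.isFwd = true ∧ (ledges a.1 a.2).count ℓ = 1 ∧
        (ledges b.1 b.2).count ℓ = 1 ∧ (rest.all fun xw => (ledges xw.1 xw.2).count ℓ == 0) = true ∧
        lendpoint b.1 b.2 = b.1 ∧ ledgesInBox B a.1 a.2 = true ∧ ledgesInBox B b.1 b.2 = true ∧
        allInBox B rest = true ∧ inBoxB B ℓ.1 = true then
      some (a.1, a.2.take ki ++ b.2.drop (kj + 1) ++ b.2.take kj ++ a.2.drop (ki + 1))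
    else none
  | _, _, _, _ => none

/-- One script step: `(number of glues, number of empty words dropped, new list)`. -/
def applyOp (B : ℕ) : GOp → List (LSite × Word 3) → Option (ℕ × ℕ × List (LSite × Word 3))
  | .glue i j ki kj, ws =>
    match ws[i]?, ws[j]? with
    | some a, some b =>
      if b ∈ ws.erase a then
        match glueData B a b ki kj ((ws.erase a).erase b) with
        | some m => some (1, 0, m :: (ws.erase a).erase b)
        | none => none
      else none
    | _, _ => none
  | .rot i, ws =>
    match ws[i]? with
    | some (x, s :: w) =>
      if lendpoint x (s :: w) = x then some (0, 0, (lapply x s, w ++ [s]) :: ws.erase (x, s :: w))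
      else none
    | _ => none
  | .bt i k, ws =>
    match ws[i]? with
    | some (x, w) =>
      match w[k]?, w[k + 1]? with
      | some s, some s' =>
        if s' = s.inv then some (0, 0, (x, w.take k ++ w.drop (k + 2)) :: ws.erase (x, w)) else none
      | _, _ => none
    | _ => none
  | .nilw i, ws =>
    match ws[i]? with
    | some (x, []) => some (0, 1, ws.erase (x, []))
    | _ => none
  | .rev i, ws =>
    match ws[i]? with
    | some (x, w) =>
      if lendpoint x w = x then some (0, 0, (x, Word.reverse w) :: ws.erase (x, w)) else none
    | _ => none

/-- Run a script; succeed only if it consumes every word: `(glues, empty words)`. -/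
def runOps (B : ℕ) : List GOp → List (LSite × Word 3) → Option (ℕ × ℕ)
  | [], ws => if ws.isEmpty then some (0, 0) else none
  | op :: ops, ws =>
    match applyOp B op ws with
    | none => none
    | some (da, db, ws') =>
      match runOps B ops ws' with
      | none => none
      | some (a, b) => some (a + da, b + db)

/-- Some word reads some link exactly once in the whole list (decided on local data). -/
def hasLonely (B : ℕ) (ws : List (LSite × Word 3)) : Bool :=
  ws.any fun xw => (ledges xw.1 xw.2).any fun ℓ =>
    ((ledges xw.1 xw.2).count ℓ == 1) && ((ws.erase xw).all fun xw' => (ledges xw'.1 xw'.2).count ℓ == 0) &&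
      ledgesInBox B xw.1 xw.2 && allInBox B (ws.erase xw) && inBoxB B ℓ.1

/-! ## Soundness -/

section Sound

variable {L : ℕ} [NeZero L] {N : ℕ} {G : Type*} [Group G] [TopologicalSpace G]
  [IsTopologicalGroup G] [CompactSpace G] [MeasurableSpace G] [BorelSpace G]
  [SecondCountableTopology G] (ρ : G →* Matrix (Fin N) (Fin N) ℂ) (y : Site 3 L) {B : ℕ}

omit [NeZero L] [MeasurableSpace G] [BorelSpace G] [SecondCountableTopology G] in
/-- **Reversing a closed word** does not change the character of its holonomy. -/
theorem reTr_wordHolonomy_reverse (hρ : Continuous ρ) (U : GaugeConfig 3 L G) {x : Site 3 L}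
    {w : Word 3} (hclosed : Word.endpoint x w = x) :
    reTr ρ (wordHolonomy U x (Word.reverse w)) = reTr ρ (wordHolonomy U x w) := by
  have h := wordHolonomy_reverse U x w
  rw [hclosed] at h
  rw [h]
  exact Literature.RepresentationTheory.CompactGroups.CompactGroup.re_trace_map_inv ρ hρ _

/-- A backtrack at positions `k, k+1` splits the word. -/
theorem eq_take_append_backtrack {w : Word 3} {k : ℕ} {s s' : Step 3} (hs : w[k]? = some s)
    (hs' : w[k + 1]? = some s') : w = w.take k ++ [s, s'] ++ w.drop (k + 2) := by
  obtain ⟨hk, rfl⟩ := List.getElem?_eq_some_iff.1 hs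
  obtain ⟨hk1, rfl⟩ := List.getElem?_eq_some_iff.1 hs'
  conv_lhs => rw [← List.take_append_drop k w, List.drop_eq_getElem_cons hk,
    List.drop_eq_getElem_cons hk1]
  simp [List.append_assoc]

omit [NeZero L] in
/-- Words of the list not reading `ℓ` locally do not read its chart image. -/
theorem not_mem_edgesRead_of_all (hB : 2 * B < L) {rest : List (LSite × Word 3)} {ℓ : LEdge}
    (hℓ : InBox B ℓ.1) (hbox : allInBox B rest = true)
    (h0 : (rest.all fun xw => (ledges xw.1 xw.2).count ℓ == 0) = true) :
    ∀ xw ∈ chartWords y rest, edge y ℓ ∉ Word.edgesRead xw.1 xw.2 := by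
  intro xw hxw
  obtain ⟨a, ha, rfl⟩ := List.mem_map.1 hxw
  simp only [allInBox, List.all_eq_true, beq_iff_eq] at hbox h0
  exact not_mem_edgesRead_of_count y hB (hbox a ha) hℓ (h0 a ha)

/-- ★ Soundness of the glue step. -/
theorem wlInt_glueData (hB : 2 * B < L) (hρ : Continuous ρ) {c₁ : ℝ}
    (hR1 : ∀ x z : G, ∫ g, reTr ρ (x * g⁻¹) * reTr ρ (g * z) ∂haarProbability G = c₁ * reTr ρ (x * z))
    {a b : LSite × Word 3} {ki kj : ℕ} {rest : List (LSite × Word 3)} {m : LSite × Word 3}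
    (h : glueData B a b ki kj rest = some m) :
    wlInt (G := G) ρ ((site y a.1, a.2) :: (site y b.1, b.2) :: chartWords y rest) =
      c₁ * wlInt ρ ((site y m.1, m.2) :: chartWords y rest) := by
  unfold glueData at h
  split at h
  · rename_i ℓ ℓ' si sj hℓ hℓ' hsi hsj
    split_ifs at h with hc
    obtain ⟨rfl, hsi', hsj', h1a, h1b, h0, hcl, hba, hbb, hbr, hℓbox⟩ := hc
    obtain ⟨hki, hsi⟩ := List.getElem?_eq_some_iff.1 hsi
    obtain ⟨hkj, hsj⟩ := List.getElem?_eq_some_iff.1 hsj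
    obtain ⟨_, hℓ⟩ := List.getElem?_eq_some_iff.1 hℓ
    obtain ⟨_, hℓ'⟩ := List.getElem?_eq_some_iff.1 hℓ'
    have hℓbox' := inBox_of_inBoxB hℓbox
    let S₁ := splitAt y hB a.1 a.2 ki hki hba ℓ' hℓ h1a
    let S₂ := splitAt y hB b.1 b.2 kj hkj hbb ℓ' hℓ' h1b
    have hS₁ : S₁.step.isFwd = false := by
      show (a.2[ki]).isFwd = false; rw [hsi]; exact hsi'
    have hS₂ : S₂.step.isFwd = true := by
      show (b.2[kj]).isFwd = true; rw [hsj]; exact hsj'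
    have hclosed : Word.endpoint (site y b.1) b.2 = site y b.1 := by rw [endpoint_site, hcl]
    have hglue := wlInt_glue ρ hρ hR1 S₁ S₂ hS₁ hS₂ hclosed (chartWords y rest)
      (not_mem_edgesRead_of_all y hB hℓbox' hbr h0)
    rw [hglue]
    cases h
    rfl
  · exact absurd h (by simp)

/-- Membership from an index. -/
theorem mem_of_getElem?_eq_some {α : Type*} {l : List α} {i : ℕ} {a : α} (h : l[i]? = some a) : a ∈ l := by
  obtain ⟨hi, rfl⟩ := List.getElem?_eq_some_iff.1 h
  exact List.getElem_mem hi

/-- ★ **Soundness of one script step.** -/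
theorem wlInt_applyOp (hB : 2 * B < L) (hρ : Continuous ρ) {c₁ : ℝ}
    (hR1 : ∀ x z : G, ∫ g, reTr ρ (x * g⁻¹) * reTr ρ (g * z) ∂haarProbability G = c₁ * reTr ρ (x * z))
    (op : GOp) {ws ws' : List (LSite × Word 3)} {da db : ℕ}
    (h : applyOp B op ws = some (da, db, ws')) :
    wlInt (G := G) ρ (chartWords y ws) = c₁ ^ da * N ^ db * wlInt ρ (chartWords y ws') := by
  classical
  cases op with
  | glue i j ki kj =>
    simp only [applyOp] at h
    split at h
    · rename_i a b ha hb
      split_ifs at h with hmem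
      split at h
      · rename_i m hm
        simp only [Option.some.injEq, Prod.mk.injEq] at h
        obtain ⟨rfl, rfl, rfl⟩ := h
        have hperm : (chartWords y ws).Perm
            ((site y a.1, a.2) :: (site y b.1, b.2) :: chartWords y ((ws.erase a).erase b)) :=
          (chartWords_erase y ws a (mem_of_getElem?_eq_some ha)).trans
            (List.Perm.cons _ (chartWords_erase y (ws.erase a) b hmem))
        rw [wlInt_perm ρ hperm, wlInt_glueData ρ y hB hρ hR1 hm, chartWords_cons]
        ring
      · exact absurd h (by simp)
    · exact absurd h (by simp)
  | rot i =>
    simp only [applyOp] at h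
    split at h
    · rename_i x s w hx
      split_ifs at h with hcl
      simp only [Option.some.injEq, Prod.mk.injEq] at h
      obtain ⟨rfl, rfl, rfl⟩ := h
      have hperm := chartWords_erase y ws (x, s :: w) (mem_of_getElem?_eq_some hx)
      rw [wlInt_perm ρ hperm, chartWords_cons, pow_zero, pow_zero, one_mul, one_mul]
      refine wlInt_cons_congr ρ (fun U => ?_) _
      have hclosed : Word.endpoint (site y x) (s :: w) = site y x := by rw [endpoint_site, hcl]
      rw [reTr_wordHolonomy_rotate ρ U s hclosed, apply_site]
    · exact absurd h (by simp)
  | bt i k =>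
    simp only [applyOp] at h
    split at h
    · rename_i x w hx
      split at h
      · rename_i s s' hs hs'
        split_ifs at h with hinv
        simp only [Option.some.injEq, Prod.mk.injEq] at h
        obtain ⟨rfl, rfl, rfl⟩ := h
        have hperm := chartWords_erase y ws (x, w) (mem_of_getElem?_eq_some hx)
        rw [wlInt_perm ρ hperm, chartWords_cons, pow_zero, pow_zero, one_mul, one_mul]
        refine wlInt_cons_congr ρ (fun U => ?_) _
        have hw := eq_take_append_backtrack hs hs'
        rw [hinv] at hw
        conv_lhs => rw [hw]
        exact reTr_wordHolonomy_backtrack ρ U (site y x) _ _ s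
      · exact absurd h (by simp)
    · exact absurd h (by simp)
  | nilw i =>
    simp only [applyOp] at h
    split at h
    · rename_i x hx
      simp only [Option.some.injEq, Prod.mk.injEq] at h
      obtain ⟨rfl, rfl, rfl⟩ := h
      have hperm := chartWords_erase y ws (x, []) (mem_of_getElem?_eq_some hx)
      rw [wlInt_perm ρ hperm]
      simp only [wlInt_cons_nil_word, pow_zero, pow_one, one_mul]
    · exact absurd h (by simp)
  | rev i =>
    simp only [applyOp] at h
    split at h
    · rename_i x w hx
      split_ifs at h with hcl
      simp only [Option.some.injEq, Prod.mk.injEq] at h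
      obtain ⟨rfl, rfl, rfl⟩ := h
      have hperm := chartWords_erase y ws (x, w) (mem_of_getElem?_eq_some hx)
      rw [wlInt_perm ρ hperm, chartWords_cons, pow_zero, pow_zero, one_mul, one_mul]
      refine wlInt_cons_congr ρ (fun U => ?_) _
      have hclosed : Word.endpoint (site y x) w = site y x := by rw [endpoint_site, hcl]
      exact (reTr_wordHolonomy_reverse ρ hρ U hclosed).symm
    · exact absurd h (by simp)

/-- ★★ **SOUNDNESS OF THE SCRIPT CHECKER**: a script consuming every word evaluates the
word-list integral as `c₁^{#glues} · N^{#empty words}`. -/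
theorem wlInt_eq_of_runOps (hB : 2 * B < L) (hρ : Continuous ρ) {c₁ : ℝ}
    (hR1 : ∀ x z : G, ∫ g, reTr ρ (x * g⁻¹) * reTr ρ (g * z) ∂haarProbability G = c₁ * reTr ρ (x * z)) :
    ∀ (ops : List GOp) (ws : List (LSite × Word 3)) {a b : ℕ}, runOps B ops ws = some (a, b) →
      wlInt (G := G) ρ (chartWords y ws) = c₁ ^ a * N ^ b
  | [], ws, a, b, h => by
    simp only [runOps] at h
    split_ifs at h with he
    simp only [Option.some.injEq, Prod.mk.injEq] at h
    obtain ⟨rfl, rfl⟩ := h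
    rw [List.isEmpty_iff] at he
    subst he
    simp [wlInt_nil]
  | op :: ops, ws, a, b, h => by
    simp only [runOps] at h
    split at h
    · exact absurd h (by simp)
    · rename_i da db ws' hop
      split at h
      · exact absurd h (by simp)
      · rename_i a' b' hrun
        simp only [Option.some.injEq, Prod.mk.injEq] at h
        obtain ⟨rfl, rfl⟩ := h
        rw [wlInt_applyOp ρ y hB hρ hR1 op hop, wlInt_eq_of_runOps hB hρ hR1 ops ws' hrun]
        ring

/-- ★ **A LONELY LINK KILLS THE DIAGRAM** (centre twist). -/
theorem wlInt_eq_zero_of_hasLonely (hB : 2 * B < L) (hρ : Continuous ρ) {z₀ : G} {ω : ℂ}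
    (hz₀ : ρ z₀ = ω • (1 : Matrix (Fin N) (Fin N) ℂ)) (hω : ω ≠ 1) {ws : List (LSite × Word 3)}
    (h : hasLonely B ws = true) : wlInt (G := G) ρ (chartWords y ws) = 0 := by
  classical
  simp only [hasLonely, List.any_eq_true, Bool.and_eq_true, beq_iff_eq] at h
  obtain ⟨xw, hxw, ℓ, hℓ, ⟨⟨⟨h1, h0⟩, hbw⟩, hbr⟩, hℓbox⟩ := h
  obtain ⟨k, hk, hkℓ⟩ := List.mem_iff_getElem.1 hℓ
  have hk' : k < xw.2.length := by simpa using hk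
  let S := splitAt y hB xw.1 xw.2 k hk' hbw ℓ hkℓ h1
  have hperm := chartWords_erase y ws xw hxw
  rw [wlInt_perm ρ hperm]
  exact wlInt_lonely ρ hρ hz₀ hω S (chartWords y (ws.erase xw))
    (not_mem_edgesRead_of_all y hB (inBox_of_inBoxB hℓbox) hbr (by simpa [List.all_eq_true] using h0))

end Sound

end DiagRPHex

end

end Summit.QuantumFields.GaugeBoot
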